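import Summits.BirchSwinnertonDyer.Rank1Residual.Additive.CensusX42Bridges
import Summits.BirchSwinnertonDyer.Rank1Residual.Additive.CongruentPartnerBranchPAdicGrossZagierIff
import Summits.BirchSwinnertonDyer.Rank1Residual.Additive.X3GordBranchPAdicGrossZagierIff
import Summits.BirchSwinnertonDyer.Rank1Residual.AdditivePotMult.X3MBranchPAdicGrossZagier
import Summits.BirchSwinnertonDyer.Rank1Residual.AdditivePotMult.PotMultCongruentPartnerMainConjecture
import Summits.BirchSwinnertonDyer.Rank1Residual.AdditivePotMult.PotMultX3BudgetRankZeroEnds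
import HarnessLib

/-!
# Census records, rank one, IMC-VERSION: on a semistable-twist row of O7-ord carrying the branch
# main conjecture's LOWER half (typed input), the census relation X4-2 for every (B)-datum ⟹
# `BSD(E,p)` (cell `b2b-bsdres`, census cell `bsd-formula-census`, seat `b2b-bsdres-census-ctyper1`
# = conjecture-typer 1, gen 4; the IMC-version twins of `CensusX42BSD{,Corollaries,Mult}.lean`
# (gen 3, CERT-version: p255301 / p255529 / p255541) over n1011-p01's IMC-version iffs p255614 /
# p255891 / p256076 and this seat's bridges `CensusX42Bridges.lean`)

HONEST FRAMING (cell `b2b-bsdres`, run/shared/lean/b2b/bsd-rank1-residual/, verbatim in every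
file): the goal of the cell is to DELETE the COMBINATION-SHAPED residual classes of the
Birch–Swinnerton-Dyer formula for ALL analytic-rank `≤ 1` elliptic curves over `ℚ` — "full BSD
formula for every rank `≤ 1` curve in class `C`" assembled STRICTLY from published theorems — so
that the rank-`≤ 1` remainder becomes exactly the CONSTRUCTION-SHAPED classes, which are TYPED
(missing-input `Prop`s), NOT attempted. This is not "finishing BSD". Census cell
(bsd-formula-census): research instrumentation; census output = EVIDENCE / conjecture items, never a
Literature fact; labels / RESIDUAL-MAP marks UNCHANGED (O7 OPEN; X3♯ / X4♯ CONSTRUCTION-SHAPED);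
nothing booked. THEOREMS ONLY (no definition, no named fact); named facts enter as HYPOTHESES
(Kato 2004 Thm. 17.4 (3) `hK`, Wuthrich 2014 Thm. 16 `hW16`/`hWu`, Delbourgo 2002 `hDel` /
`hDel3` / `hDelM`, Gross–Zagier I.(7.3) `hGZ`, GZK `hGZK`, modularity `hmod` / `hmodD`); the
Λ-adic LOWER node (`ChiBranchLowerDivisibility[Odd]At W p`, n1011-p07; `QuadraticBranchLowerDivisibilityAt
V p`, p10) is a TYPED INPUT (hypothesis); the census relation `CensusX42.RelationAt W p Dh` is a
HYPOTHESIS for every (B)-datum (CANDIDATE; X42-REPORT.md sha256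
`e8592c9a2e1a59c13e754928288c9f6b1ce554f7ffb80b93db3c55aa7f5e9950`).

## What

n1011-p01 proved (IMC-version, rows of O7-ord with a semistable twist): branch IMC (typed LOWER +
the published half) ∧ Delbourgo 2002 ∧ [Schneider rider ∧ typed `p`-adic Gross–Zagier for every
(B)-datum] ⟹ `BSD(E,p)`. `CensusX42Bridges.lean` reads BOTH bracketed evidence-binders off the
census relation at the pair (`schneider_of_relationAt[_mult]`,
`branchPAdicGrossZagier[Odd|Mult]At_of_relationAt`; the even bridge is gen 2's p253175). Hence, on
every such row, **typed LOWER + (∀ (B)-datum, census relation) ⟹ `BSD(E,p)`**: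
§1 X4♯(G-ord) ∩ `I₀*` ∩ {`ρ̄` onto} — even (`p ≡ 1 (mod 4)`), odd (`p ≥ 7`), `p = 3`; §2 X3♯(G-ord)
∩ `I₀*` (Wuthrich's half, NO image hypothesis) — even, odd, `p = 3`; §3 X4(M) ∩ {`ρ̄` onto} and
X3♯(M), EVERY odd `p`. Compared with the CERT-version (gen 3): no certificate binder, instead the
typed LOWER — which is itself a THEOREM per pair from a unit coefficient at ANY index `b` + the
budget `BudgetLeLambdaAt p W b` (p10 K-OUT p255527 on the big-image (G-ord) rows; p07-g3 /
n1011-p12 on the (M) rows from this seat's Q6 records `CensusQ6.Mult[Odd]FirstUnitIndexAt W p b`);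
§4 composes: **index-`b` certificate / Q6 record + budget + (∀ (B)-datum, census relation) ⟹
`BSD(E,p)`** on X4♯(G-ord) (`p ≡ 1 (mod 4)`; `p ≡ 3 (mod 4)`, `p ≥ 7`; `p = 3`), X4(M) and X3♯(M) —
reaching the rows whose first unit index is `≥ 2` (n1011-r2's TAM2+ / SHA3 / L2 types), where gen
3's CERT-version (index `1`) is silent. EVIDENCE-conditional; nothing about any curve is asserted;
nothing booked.

References: K. Kato, Astérisque 295 (2004) Thm. 17.4 (3) [Kato2004Asterisque]; C. Wuthrich, Doc. Math.
19 (2014) Thm. 16 [Wuthrich2014]; D. Delbourgo, J. Number Theory 95 (2002) Thm. (A)/(B)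
[Delbourgo2002]; B. Gross, D. Zagier, Invent. Math. 84 (1986) Thm. I.(7.3) [GrossZagier1986];
A. Pal, Proc. AMS 140 (2012) Thm. 3.2 [Pal2012]; R. L. Miller, LMS J. Comput. Math. 14 (2011) Def.
1.1 [Miller2011LMS]; census files of record (module docstring of `CensusX42LeadingTerm.lean`).
-/

set_option autoImplicit false

noncomputable section

open scoped Classical MatrixGroups ModularForm NumberField

open CongruenceSubgroup WeierstrassCurve NumberField Literature.NumberTheory.EllipticCurves
  Literature.NumberTheory.EllipticCurves.ModularForms
  Literature.NumberTheory.EllipticCurves.Rank1Residual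
  Literature.NumberTheory.EllipticCurves.Rank1Residual.Typed
  Literature.NumberTheory.EllipticCurves.Delbourgo2002
  Literature.NumberTheory.GaloisRepresentations
  Summit.BirchSwinnertonDyer.Rank1Residual.AdditivePotMult
  IsDedekindDomain

namespace Summit.BirchSwinnertonDyer.Rank1Residual.Additive

open CensusX42

variable {W : WeierstrassCurve ℚ} [W.IsElliptic] [W.IsGloballyMinimal] {p : ℕ} [hp : Fact p.Prime]

/-! ### §1 X4♯(G-ord) ∩ `I₀*` ∩ {`ρ̄` onto}: typed LOWER + census relation for every (B)-datum ⟹ `BSD(E,p)` -/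

/-- **IMC-VERSION NODE, (G-ord), `p ≡ 1 (mod 4)`, non-anomalous, `r_an = 1`** (non-CM is AUTOMATIC at
`p ≥ 5` from `ρ̄` onto: p01's `ClassX4Gord.not_hasCM_of_surj_of_five_le`): Kato half
(`hK`) + the typed Λ-adic LOWER `ChiBranchLowerDivisibilityAt W p` + Delbourgo 2002 + GZ + GZK +
modularity + **the census relation for every (B)-datum** ⟹ `BSD(E,p)` (p01's
`…_of_chiBranchLower_of_katoHalf_of_branchPAdicGrossZagier` with rider and typed GZ read off the
relation). [cite: Kato2004Asterisque, Thm. 17.4 (3) (p. 273)] [cite: Delbourgo2002, Theorem (A), (B) (p. 40)]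
[cite: GrossZagier1986, Thm. I.(7.3)] [cite: Miller2011LMS, Def. 1.1] -/
theorem ClassX4Gord.bsdp_rankOne_of_chiBranchLower_of_katoHalf_of_forall_censusX42
    (hDel : Delbourgo2002.mainTheorem)
    (hK : Wuthrich2014.kato_halfEigenCharIdeal_dvd_cyclotomicPrime_of_surjective)
    (hGZ : GrossZagier1986_thm_I_7_3) (hmod : hasEntireLFunction_rat)
    (hmodD : nonempty_modularParametrizationData) (hGZK : rank_eq_analyticRank_of_analyticRank_le_one)
    (hX : ClassX4Gord W p) (he : semistabilityIndex W p = 2) (hp4 : p % 4 = 1)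
    (hna : ReductionNonAnomalous W p) (hsurj : Surj W p) (hr : W.analyticRank = 1)
    (hdiv : ChiBranchLowerDivisibilityAt W p)
    (hrel : ∀ Dh : PAdicHeightData W p, LeadingTermClauses W p Dh → RelationAt W p Dh) : BSDp W p :=
  have hp5 : 5 ≤ p := by have := hp.out.two_le; omega
  hX.bsdp_rankOne_of_chiBranchLower_of_katoHalf_of_branchPAdicGrossZagier hDel hK hmod hmodD hGZK he hp4
    (hX.not_hasCM_of_surj_of_five_le he hp5 hsurj) hna hsurj hr hdiv fun Dh hB ↦
      ⟨schneider_of_relationAt hGZ hGZK hmodD hX.addv.1 hX.typeGOrd hX.addv.2 he hr (hrel Dh hB),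
        branchPAdicGrossZagierAt_of_relationAt p hGZ hGZK W hX.addv.2 hr Dh (hrel Dh hB)⟩

/-- **IMC-VERSION NODE, (G-ord), `p ≡ 3 (mod 4)`, `p ≥ 5`, non-anomalous, `r_an = 1`** (no CM binder; odd
LOWER `ChiBranchLowerDivisibilityOddAt W p`; odd bridge). [cite: Kato2004Asterisque, Thm. 17.4 (3) (p. 273)]
[cite: Delbourgo2002, Theorem (A), (B) (p. 40)] [cite: GrossZagier1986, Thm. I.(7.3)] [cite: Miller2011LMS, Def. 1.1] -/
theorem ClassX4Gord.bsdp_rankOne_of_chiBranchLowerOdd_of_katoHalf_of_forall_censusX42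
    (hDel : Delbourgo2002.mainTheorem)
    (hK : Wuthrich2014.kato_halfEigenCharIdeal_dvd_cyclotomicPrime_of_surjective)
    (hGZ : GrossZagier1986_thm_I_7_3) (hmod : hasEntireLFunction_rat)
    (hmodD : nonempty_modularParametrizationData) (hGZK : rank_eq_analyticRank_of_analyticRank_le_one)
    (hX : ClassX4Gord W p) (he : semistabilityIndex W p = 2) (hp4 : p % 4 = 3) (hp5 : 5 ≤ p)
    (hna : ReductionNonAnomalous W p) (hsurj : Surj W p) (hr : W.analyticRank = 1)
    (hdiv : ChiBranchLowerDivisibilityOddAt W p)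
    (hrel : ∀ Dh : PAdicHeightData W p, LeadingTermClauses W p Dh → RelationAt W p Dh) : BSDp W p :=
  hX.bsdp_rankOne_of_chiBranchLowerOdd_of_katoHalf_of_branchPAdicGrossZagierOdd hDel hK hmod hmodD hGZK he
    hp4 hp5 (hX.not_hasCM_of_surj_of_five_le he hp5 hsurj) hna hsurj hr hdiv fun Dh hB ↦
      ⟨schneider_of_relationAt hGZ hGZK hmodD hX.addv.1 hX.typeGOrd hX.addv.2 he hr (hrel Dh hB),
        branchPAdicGrossZagierOddAt_of_relationAt hGZ hGZK W hX.addv.1 hX.addv.2 hr Dh (hrel Dh hB)⟩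

/-- **IMC-VERSION NODE at `p = 3`, (G-ord), non-CM, non-anomalous, `ρ̄_{E,3}` onto, `r_an = 1`**
(`hDel3 = Delbourgo2002.mainTheorem_three`; defect `2` automatic). [cite: Kato2004Asterisque, Thm. 17.4 (3) (p. 273)]
[cite: Delbourgo2002, Theorem (A), (B), Example (p. 40)] [cite: GrossZagier1986, Thm. I.(7.3)]
[cite: Miller2011LMS, Def. 1.1] -/
theorem ClassX4Gord.bsdp_three_rankOne_of_chiBranchLowerOdd_of_katoHalf_of_forall_censusX42
    [Fact (Nat.Prime 3)] {W : WeierstrassCurve ℚ} [W.IsElliptic] [W.IsGloballyMinimal]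
    (hDel3 : Delbourgo2002.mainTheorem_three)
    (hK : Wuthrich2014.kato_halfEigenCharIdeal_dvd_cyclotomicPrime_of_surjective)
    (hGZ : GrossZagier1986_thm_I_7_3) (hmod : hasEntireLFunction_rat)
    (hmodD : nonempty_modularParametrizationData) (hGZK : rank_eq_analyticRank_of_analyticRank_le_one)
    (hX : ClassX4Gord W 3) (hcm : ¬ W.HasCM) (hna : ReductionNonAnomalous W 3) (hsurj : Surj W 3)
    (hr : W.analyticRank = 1) (hdiv : ChiBranchLowerDivisibilityOddAt W 3)
    (hrel : ∀ Dh : PAdicHeightData W 3, LeadingTermClauses W 3 Dh → RelationAt W 3 Dh) : BSDp W 3 :=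
  have he : semistabilityIndex W 3 = 2 :=
    semistabilityIndex_eq_two_of_typeG_three W hX.typeGOrd.typeG hX.addv.2
  hX.bsdp_three_rankOne_of_chiBranchLowerOdd_of_katoHalf_of_branchPAdicGrossZagierOdd hDel3 hK hmod hmodD
    hGZK hcm hna hsurj hr hdiv fun Dh hB ↦
      ⟨schneider_of_relationAt hGZ hGZK hmodD hX.addv.1 hX.typeGOrd hX.addv.2 he hr (hrel Dh hB),
        branchPAdicGrossZagierOddAt_of_relationAt hGZ hGZK W hX.addv.1 hX.addv.2 hr Dh (hrel Dh hB)⟩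

/-! ### §2 X3♯(G-ord) ∩ `I₀*` (reducible `E[p]`, Wuthrich's half, NO image hypothesis) -/

/-- **IMC-VERSION NODE on X3♯(G-ord), `p ≡ 1 (mod 4)`, non-CM, non-anomalous, `r_an = 1`:** Wuthrich
Thm. 16 half (`hWu`) + typed LOWER + Delbourgo 2002 + GZ + GZK + modularity + the census relation for
every (B)-datum ⟹ `BSD(E,p)`. [cite: Wuthrich2014, Thm. 16 (p. 397)] [cite: Delbourgo2002, Theorem (A), (B) (p. 40)]
[cite: GrossZagier1986, Thm. I.(7.3)] [cite: Miller2011LMS, Def. 1.1] -/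
theorem ClassX3Gord.bsdp_rankOne_of_chiBranchLower_of_wuthrichHalf_of_forall_censusX42
    (hDel : Delbourgo2002.mainTheorem) (hWu : Wuthrich2014.thm16_halfEigenCharIdeal_dvd_cyclotomicPrime)
    (hGZ : GrossZagier1986_thm_I_7_3) (hmod : hasEntireLFunction_rat)
    (hmodD : nonempty_modularParametrizationData) (hGZK : rank_eq_analyticRank_of_analyticRank_le_one)
    (hX : ClassX3Gord W p) (he : semistabilityIndex W p = 2) (hp4 : p % 4 = 1) (hcm : ¬ W.HasCM)
    (hna : ReductionNonAnomalous W p) (hr : W.analyticRank = 1) (hdiv : ChiBranchLowerDivisibilityAt W p)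
    (hrel : ∀ Dh : PAdicHeightData W p, LeadingTermClauses W p Dh → RelationAt W p Dh) : BSDp W p :=
  have hp2 : p ≠ 2 := by omega
  hX.bsdp_rankOne_of_chiBranchLower_of_wuthrichHalf_of_branchPAdicGrossZagier hDel hWu hmod hmodD hGZK he
    hp4 hcm hna hr hdiv fun Dh hB ↦
      ⟨schneider_of_relationAt hGZ hGZK hmodD hp2 hX.typeGOrd hX.addv he hr (hrel Dh hB),
        branchPAdicGrossZagierAt_of_relationAt p hGZ hGZK W hX.addv hr Dh (hrel Dh hB)⟩

/-- **IMC-VERSION NODE on X3♯(G-ord), `p ≡ 3 (mod 4)`, `p ≥ 5`, non-CM, non-anomalous, `r_an = 1`.**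
[cite: Wuthrich2014, Thm. 16 (p. 397)] [cite: Delbourgo2002, Theorem (A), (B) (p. 40)]
[cite: GrossZagier1986, Thm. I.(7.3)] [cite: Miller2011LMS, Def. 1.1] -/
theorem ClassX3Gord.bsdp_rankOne_of_chiBranchLowerOdd_of_wuthrichHalf_of_forall_censusX42
    (hDel : Delbourgo2002.mainTheorem) (hWu : Wuthrich2014.thm16_halfEigenCharIdeal_dvd_cyclotomicPrime)
    (hGZ : GrossZagier1986_thm_I_7_3) (hmod : hasEntireLFunction_rat)
    (hmodD : nonempty_modularParametrizationData) (hGZK : rank_eq_analyticRank_of_analyticRank_le_one)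
    (hX : ClassX3Gord W p) (he : semistabilityIndex W p = 2) (hp4 : p % 4 = 3) (hp5 : 5 ≤ p)
    (hcm : ¬ W.HasCM) (hna : ReductionNonAnomalous W p) (hr : W.analyticRank = 1)
    (hdiv : ChiBranchLowerDivisibilityOddAt W p)
    (hrel : ∀ Dh : PAdicHeightData W p, LeadingTermClauses W p Dh → RelationAt W p Dh) : BSDp W p :=
  have hp2 : p ≠ 2 := by omega
  hX.bsdp_rankOne_of_chiBranchLowerOdd_of_wuthrichHalf_of_branchPAdicGrossZagierOdd hDel hWu hmod hmodD hGZK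
    he hp4 hp5 hcm hna hr hdiv fun Dh hB ↦
      ⟨schneider_of_relationAt hGZ hGZK hmodD hp2 hX.typeGOrd hX.addv he hr (hrel Dh hB),
        branchPAdicGrossZagierOddAt_of_relationAt hGZ hGZK W hp2 hX.addv hr Dh (hrel Dh hB)⟩

/-- **IMC-VERSION NODE on X3♯(G-ord) at `p = 3`, non-CM, non-anomalous, `r_an = 1`** (defect `2`
automatic; `hDel3`). [cite: Wuthrich2014, Thm. 16 (p. 397)] [cite: Delbourgo2002, Theorem (A), (B), Example (p. 40)]
[cite: GrossZagier1986, Thm. I.(7.3)] [cite: Miller2011LMS, Def. 1.1] -/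
theorem ClassX3Gord.bsdp_three_rankOne_of_chiBranchLowerOdd_of_wuthrichHalf_of_forall_censusX42
    [Fact (Nat.Prime 3)] {W : WeierstrassCurve ℚ} [W.IsElliptic] [W.IsGloballyMinimal]
    (hDel3 : Delbourgo2002.mainTheorem_three)
    (hWu : Wuthrich2014.thm16_halfEigenCharIdeal_dvd_cyclotomicPrime)
    (hGZ : GrossZagier1986_thm_I_7_3) (hmod : hasEntireLFunction_rat)
    (hmodD : nonempty_modularParametrizationData) (hGZK : rank_eq_analyticRank_of_analyticRank_le_one)
    (hX : ClassX3Gord W 3) (hcm : ¬ W.HasCM) (hna : ReductionNonAnomalous W 3) (hr : W.analyticRank = 1)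
    (hdiv : ChiBranchLowerDivisibilityOddAt W 3)
    (hrel : ∀ Dh : PAdicHeightData W 3, LeadingTermClauses W 3 Dh → RelationAt W 3 Dh) : BSDp W 3 :=
  have he : semistabilityIndex W 3 = 2 :=
    semistabilityIndex_eq_two_of_typeG_three W hX.typeGOrd.typeG hX.addv
  hX.bsdp_three_rankOne_of_chiBranchLowerOdd_of_wuthrichHalf_of_branchPAdicGrossZagierOdd hDel3 hWu hmod
    hmodD hGZK hcm hna hr hdiv fun Dh hB ↦
      ⟨schneider_of_relationAt hGZ hGZK hmodD (by decide) hX.typeGOrd hX.addv he hr (hrel Dh hB),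
        branchPAdicGrossZagierOddAt_of_relationAt hGZ hGZK W (by decide) hX.addv hr Dh (hrel Dh hB)⟩


/-! ### §4a Three inputs on X4♯(G-ord) ∩ `I₀*` ∩ {`ρ̄` onto}: index-`b` certificate + budget + census relation ⟹ `BSD(E,p)` -/

/-- **THREE-INPUT NODE, (G-ord), `p ≡ 1 (mod 4)`, non-anomalous, `r_an = 1` (no CM binder):** Kato half +
p10's index-`b` certificate `BranchUnitCoeffAt W p b` (= a Q6 record at `n₀ = b` by
`CensusQ6.branchUnitCoeffAt_of_gordFirstUnitIndexAt`, `CensusQ6CoeffValuation.lean`) +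
`BudgetLeLambdaAt p W b` + Delbourgo 2002 + GZ + GZK + modularity + the census relation for every
(B)-datum ⟹ `BSD(E,p)` — the LOWER by p10's K-OUT `…chiBranchLowerDivisibilityAt_of_katoHalf_of_coeffCert_of_budget`,
then §1. ANY first unit index `b`. [cite: Kato2004Asterisque, Thm. 17.4 (3) (p. 273)]
[cite: EmertonPollackWeston2006, Cor. 3.2.5 (source of the budget input)] [cite: Delbourgo2002, Theorem (A), (B) (p. 40)]
[cite: GrossZagier1986, Thm. I.(7.3)] [cite: Miller2011LMS, Def. 1.1] -/
theorem ClassX4Gord.bsdp_rankOne_of_katoHalf_of_coeffCert_of_budget_of_forall_censusX42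
    (hDel : Delbourgo2002.mainTheorem)
    (hK : Wuthrich2014.kato_halfEigenCharIdeal_dvd_cyclotomicPrime_of_surjective)
    (hGZ : GrossZagier1986_thm_I_7_3) (hmod : hasEntireLFunction_rat)
    (hmodD : nonempty_modularParametrizationData) (hGZK : rank_eq_analyticRank_of_analyticRank_le_one)
    (hX : ClassX4Gord W p) (he : semistabilityIndex W p = 2) (hp4 : p % 4 = 1)
    (hna : ReductionNonAnomalous W p) (hsurj : Surj W p) (hr : W.analyticRank = 1)
    {b : ℕ} (hcert : BranchUnitCoeffAt W p b) (hbud : BudgetLeLambdaAt p W b)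
    (hrel : ∀ Dh : PAdicHeightData W p, LeadingTermClauses W p Dh → RelationAt W p Dh) : BSDp W p :=
  hX.bsdp_rankOne_of_chiBranchLower_of_katoHalf_of_forall_censusX42 hDel hK hGZ hmod hmodD hGZK he hp4
    hna hsurj hr (hX.chiBranchLowerDivisibilityAt_of_katoHalf_of_coeffCert_of_budget hK he hsurj hcert hbud)
    hrel

/-- **THREE-INPUT NODE, (G-ord), `p ≡ 3 (mod 4)`, `p ≥ 5`, non-anomalous, `r_an = 1`** (no CM binder; odd
LOWER by p10's `…chiBranchLowerDivisibilityOddAt_of_katoHalf_of_coeffCert_of_budget`).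
[cite: Kato2004Asterisque, Thm. 17.4 (3) (p. 273)] [cite: EmertonPollackWeston2006, Cor. 3.2.5 (source of the budget input)]
[cite: Delbourgo2002, Theorem (A), (B) (p. 40)] [cite: GrossZagier1986, Thm. I.(7.3)] [cite: Miller2011LMS, Def. 1.1] -/
theorem ClassX4Gord.bsdp_rankOne_of_katoHalf_of_coeffCert_of_budget_of_forall_censusX42_odd
    (hDel : Delbourgo2002.mainTheorem)
    (hK : Wuthrich2014.kato_halfEigenCharIdeal_dvd_cyclotomicPrime_of_surjective)
    (hGZ : GrossZagier1986_thm_I_7_3) (hmod : hasEntireLFunction_rat)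
    (hmodD : nonempty_modularParametrizationData) (hGZK : rank_eq_analyticRank_of_analyticRank_le_one)
    (hX : ClassX4Gord W p) (he : semistabilityIndex W p = 2) (hp4 : p % 4 = 3) (hp5 : 5 ≤ p)
    (hna : ReductionNonAnomalous W p) (hsurj : Surj W p) (hr : W.analyticRank = 1)
    {b : ℕ} (hcert : BranchUnitCoeffAt W p b) (hbud : BudgetLeLambdaAt p W b)
    (hrel : ∀ Dh : PAdicHeightData W p, LeadingTermClauses W p Dh → RelationAt W p Dh) : BSDp W p :=
  hX.bsdp_rankOne_of_chiBranchLowerOdd_of_katoHalf_of_forall_censusX42 hDel hK hGZ hmod hmodD hGZK he hp4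
    hp5 hna hsurj hr
    (hX.chiBranchLowerDivisibilityOddAt_of_katoHalf_of_coeffCert_of_budget hK he hsurj hcert hbud) hrel

/-- **THREE-INPUT NODE at `p = 3`, (G-ord), non-CM, non-anomalous, `ρ̄_{E,3}` onto, `r_an = 1`**
(defect `2` automatic; p14's tower inside p10's K-OUT). [cite: Kato2004Asterisque, Thm. 17.4 (3) (p. 273)]
[cite: EmertonPollackWeston2006, Cor. 3.2.5 (source of the budget input)]
[cite: Delbourgo2002, Theorem (A), (B), Example (p. 40)] [cite: GrossZagier1986, Thm. I.(7.3)]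
[cite: Miller2011LMS, Def. 1.1] -/
theorem ClassX4Gord.bsdp_three_rankOne_of_katoHalf_of_coeffCert_of_budget_of_forall_censusX42
    [Fact (Nat.Prime 3)] {W : WeierstrassCurve ℚ} [W.IsElliptic] [W.IsGloballyMinimal]
    (hDel3 : Delbourgo2002.mainTheorem_three)
    (hK : Wuthrich2014.kato_halfEigenCharIdeal_dvd_cyclotomicPrime_of_surjective)
    (hGZ : GrossZagier1986_thm_I_7_3) (hmod : hasEntireLFunction_rat)
    (hmodD : nonempty_modularParametrizationData) (hGZK : rank_eq_analyticRank_of_analyticRank_le_one)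
    (hX : ClassX4Gord W 3) (hcm : ¬ W.HasCM) (hna : ReductionNonAnomalous W 3) (hsurj : Surj W 3)
    (hr : W.analyticRank = 1) {b : ℕ} (hcert : BranchUnitCoeffAt W 3 b) (hbud : BudgetLeLambdaAt 3 W b)
    (hrel : ∀ Dh : PAdicHeightData W 3, LeadingTermClauses W 3 Dh → RelationAt W 3 Dh) : BSDp W 3 :=
  have he : semistabilityIndex W 3 = 2 :=
    semistabilityIndex_eq_two_of_typeG_three W hX.typeGOrd.typeG hX.addv.2
  hX.bsdp_three_rankOne_of_chiBranchLowerOdd_of_katoHalf_of_forall_censusX42 hDel3 hK hGZ hmod hmodD hGZK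
    hcm hna hsurj hr
    (hX.chiBranchLowerDivisibilityOddAt_of_katoHalf_of_coeffCert_of_budget hK he hsurj hcert hbud) hrel

end Summit.BirchSwinnertonDyer.Rank1Residual.Additive

/-! ### §3 The (M) rows: X4(M) ∩ {`ρ̄` onto} and X3♯(M), EVERY odd `p` -/

namespace Summit.BirchSwinnertonDyer.Rank1Residual.AdditivePotMult

open CongruenceSubgroup WeierstrassCurve NumberField Literature.NumberTheory.EllipticCurves
  Literature.NumberTheory.EllipticCurves.ModularForms
  Literature.NumberTheory.EllipticCurves.Rank1Residual
  Literature.NumberTheory.EllipticCurves.Rank1Residual.Typed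
  Literature.NumberTheory.EllipticCurves.Delbourgo2002
  Literature.NumberTheory.GaloisRepresentations
  Summit.BirchSwinnertonDyer.Rank1Residual.Additive
  Summit.BirchSwinnertonDyer.Rank1Residual.Additive.CensusX42
  IsDedekindDomain

variable {W : WeierstrassCurve ℚ} [W.IsElliptic] [W.IsGloballyMinimal] {p : ℕ} [hp : Fact p.Prime]

/-- **IMC-VERSION NODE on X4(M) ∩ {`ρ̄_{E,p}` onto}, EVERY odd `p` (`p = 3` included), `r_an = 1`:**
Kato half (`hK`) + p10's typed LOWER `QuadraticBranchLowerDivisibilityAt V p` on every multiplicative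
twist model (`hc`) + Delbourgo 2002 (M) (`hDelM`) + GZ + GZK + modularity + the census relation for
every (B)-datum ⟹ `BSD(E,p)` (p01's `ClassX4M.bsdp_rankOne_of_quadraticBranchLower_of_katoHalf_of_branchPAdicGrossZagierMult`
with rider and typed (M) GZ read off the relation). [cite: Kato2004Asterisque, Thm. 17.4 (3) (p. 273)]
[cite: Delbourgo2002, Theorem (A), (B), Example (p. 40)] [cite: GrossZagier1986, Thm. I.(7.3)]
[cite: Miller2011LMS, Def. 1.1] -/
theorem ClassX4M.bsdp_rankOne_of_quadraticBranchLower_of_katoHalf_of_forall_censusX42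
    (hDelM : Delbourgo2002.mainTheorem_potMult)
    (hK : Wuthrich2014.kato_halfEigenCharIdeal_dvd_cyclotomicPrime_of_surjective)
    (hGZ : GrossZagier1986_thm_I_7_3) (hmod : hasEntireLFunction_rat)
    (hmodD : nonempty_modularParametrizationData) (hGZK : rank_eq_analyticRank_of_analyticRank_le_one)
    (hX : ClassX4M W p) (hsurj : Surj W p) (hr : W.analyticRank = 1)
    (hc : ∀ (V : WeierstrassCurve ℚ) [V.IsElliptic] [V.IsGloballyMinimal],
      (∃ C : VariableChange ℚ, C • V.quadraticTwist ((-1) ^ (p / 2) * p : ℚ) = W) →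
        QuadraticBranchLowerDivisibilityAt V p)
    (hrel : ∀ Dh : PAdicHeightData W p, LeadingTermClauses W p Dh → RelationAt W p Dh) : BSDp W p :=
  hX.bsdp_rankOne_of_quadraticBranchLower_of_katoHalf_of_branchPAdicGrossZagierMult hDelM hK hmod hmodD
    hGZK hsurj hr hc fun Dh hB ↦
      ⟨schneider_of_relationAt_mult hGZ hGZK hmodD hX.p_ne_two (ClassX4M.potMult W p hX) hr (hrel Dh hB),
        branchPAdicGrossZagierMultAt_of_relationAt hGZ hGZK W hX.classX4.2.1 hr Dh (hrel Dh hB)⟩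

/-- **IMC-VERSION NODE on X3♯(M) (reducible `E[p]`), EVERY odd `p`, `r_an = 1`** — Wuthrich's half
(`hW16`), NO surjectivity / tower / CM / anomalous binder (p01's
`ClassX3M.bsdp_rankOne_of_quadraticBranchLower_of_wuthrichHalf_of_branchPAdicGrossZagierMult`).
[cite: Wuthrich2014, Thm. 16 (p. 397)] [cite: Delbourgo2002, Theorem (A), (B), Example (p. 40)]
[cite: GrossZagier1986, Thm. I.(7.3)] [cite: Miller2011LMS, Def. 1.1] -/
theorem ClassX3M.bsdp_rankOne_of_quadraticBranchLower_of_wuthrichHalf_of_forall_censusX42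
    (hDelM : Delbourgo2002.mainTheorem_potMult)
    (hW16 : Wuthrich2014.thm16_halfEigenCharIdeal_dvd_cyclotomicPrime)
    (hGZ : GrossZagier1986_thm_I_7_3) (hmod : hasEntireLFunction_rat)
    (hmodD : nonempty_modularParametrizationData) (hGZK : rank_eq_analyticRank_of_analyticRank_le_one)
    (hX : ClassX3M W p) (hr : W.analyticRank = 1)
    (hc : ∀ (V : WeierstrassCurve ℚ) [V.IsElliptic] [V.IsGloballyMinimal],
      (∃ C : VariableChange ℚ, C • V.quadraticTwist ((-1) ^ (p / 2) * p : ℚ) = W) →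
        QuadraticBranchLowerDivisibilityAt V p)
    (hrel : ∀ Dh : PAdicHeightData W p, LeadingTermClauses W p Dh → RelationAt W p Dh) : BSDp W p :=
  hX.bsdp_rankOne_of_quadraticBranchLower_of_wuthrichHalf_of_branchPAdicGrossZagierMult hDelM hW16 hmod
    hmodD hGZK hr hc fun Dh hB ↦
      ⟨schneider_of_relationAt_mult hGZ hGZK hmodD (ClassX3M.p_ne_two W p hX) (ClassX3M.potMult W p hX) hr
          (hrel Dh hB),
        branchPAdicGrossZagierMultAt_of_relationAt hGZ hGZK W (ClassX3M.classX3 W p hX).2 hr Dh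
          (hrel Dh hB)⟩


/-! ### §4b Three inputs on the (M) rows: Q6 record at index `b` + budget + census relation ⟹ `BSD(E,p)` -/

/-- **THREE-INPUT NODE on X4(M) ∩ {`ρ̄_{E,p}` onto}, EVERY odd `p`, `r_an = 1`:** Kato half + this
seat's Q6 record of the parity of `(p−1)/2` at index `b` (`CensusQ6.Mult[Odd]FirstUnitIndexAt W p b`)
+ `BudgetLeLambdaAt p W b` + Delbourgo 2002 (M) + GZ + GZK + modularity + the census relation for every
(B)-datum ⟹ `BSD(E,p)` — the LOWER on every twist model by p07-g3's
`ClassX4M.forall_quadraticBranchLowerDivisibilityAt_of_katoHalf_of_firstUnitIndex_of_budget'`, then §3.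
[cite: Kato2004Asterisque, Thm. 17.4 (3) (p. 273)] [cite: EmertonPollackWeston2006, Cor. 3.2.5 (source of the budget input)]
[cite: Delbourgo2002, Theorem (A), (B), Example (p. 40)] [cite: GrossZagier1986, Thm. I.(7.3)]
[cite: Miller2011LMS, Def. 1.1] -/
theorem ClassX4M.bsdp_rankOne_of_katoHalf_of_multFirstUnitIndexAt_of_budget_of_forall_censusX42
    (hDelM : Delbourgo2002.mainTheorem_potMult)
    (hK : Wuthrich2014.kato_halfEigenCharIdeal_dvd_cyclotomicPrime_of_surjective)
    (hGZ : GrossZagier1986_thm_I_7_3) (hmod : hasEntireLFunction_rat)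
    (hmodD : nonempty_modularParametrizationData) (hGZK : rank_eq_analyticRank_of_analyticRank_le_one)
    (hX : ClassX4M W p) (hsurj : Surj W p) (hr : W.analyticRank = 1) {b : ℕ}
    (hrec : (p % 4 = 1 → CensusQ6.MultFirstUnitIndexAt W p b) ∧
      (p % 4 = 3 → CensusQ6.MultOddFirstUnitIndexAt W p b))
    (hbud : BudgetLeLambdaAt p W b)
    (hrel : ∀ Dh : PAdicHeightData W p, LeadingTermClauses W p Dh → RelationAt W p Dh) : BSDp W p :=
  hX.bsdp_rankOne_of_quadraticBranchLower_of_katoHalf_of_forall_censusX42 hDelM hK hGZ hmod hmodD hGZK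
    hsurj hr
    (hX.forall_quadraticBranchLowerDivisibilityAt_of_katoHalf_of_firstUnitIndex_of_budget' hK hsurj hrec hbud)
    hrel

/-- **THREE-INPUT NODE on X3♯(M), EVERY odd `p`, `r_an = 1`** (Wuthrich's half; NO surjectivity /
tower / CM / anomalous binder): Q6 record at index `b` + budget + Delbourgo 2002 (M) + GZ + GZK +
modularity + the census relation for every (B)-datum ⟹ `BSD(E,p)` — the LOWER by n1011-p12's
`ClassX3M.forall_quadraticBranchLowerDivisibilityAt_of_wuthrichHalf_of_firstUnitIndex_of_budget'`.
BUDGET CAVEAT (n1011-r2 ROUTE-2 §II.13.2): `hbud` is a typed binder; on X3 rows (reducible `E[p]`) its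
discharge is in print only for `b ≤ rank E(ℚ)` (p07's `budgetLeLambdaAt_of_le_mordellWeilRank`); for
`b > rank` NO printed source at an additive prime (flag `X3-budget-unprinted`) — no EPW cite here.
[cite: Wuthrich2014, Thm. 16 (p. 397)] [cite: Delbourgo2002, Theorem (A), (B), Example (p. 40)]
[cite: GrossZagier1986, Thm. I.(7.3)] [cite: Miller2011LMS, Def. 1.1] -/
theorem ClassX3M.bsdp_rankOne_of_wuthrichHalf_of_multFirstUnitIndexAt_of_budget_of_forall_censusX42
    (hDelM : Delbourgo2002.mainTheorem_potMult)
    (hW16 : Wuthrich2014.thm16_halfEigenCharIdeal_dvd_cyclotomicPrime)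
    (hGZ : GrossZagier1986_thm_I_7_3) (hmod : hasEntireLFunction_rat)
    (hmodD : nonempty_modularParametrizationData) (hGZK : rank_eq_analyticRank_of_analyticRank_le_one)
    (hX : ClassX3M W p) (hr : W.analyticRank = 1) {b : ℕ}
    (hrec : (p % 4 = 1 → CensusQ6.MultFirstUnitIndexAt W p b) ∧
      (p % 4 = 3 → CensusQ6.MultOddFirstUnitIndexAt W p b))
    (hbud : BudgetLeLambdaAt p W b)
    (hrel : ∀ Dh : PAdicHeightData W p, LeadingTermClauses W p Dh → RelationAt W p Dh) : BSDp W p :=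
  hX.bsdp_rankOne_of_quadraticBranchLower_of_wuthrichHalf_of_forall_censusX42 hDelM hW16 hGZ hmod hmodD
    hGZK hr (hX.forall_quadraticBranchLowerDivisibilityAt_of_wuthrichHalf_of_firstUnitIndex_of_budget' hW16
      hrec hbud) hrel

end Summit.BirchSwinnertonDyer.Rank1Residual.AdditivePotMult

end
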